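import Summits.CriticalPhenomena.PercolationContinuityZ3.Theorems.Transplant.PlanarSkeletonFrmFromDefs
import Summits.CriticalPhenomena.PercolationContinuityZ3.Theorems.Transplant.SkelFrmFromBChoiceResidF
import Summits.CriticalPhenomena.PercolationContinuityZ3.Theorems.Transplant.SkelFrmBChoiceResidF
import Summits.CriticalPhenomena.PercolationContinuityZ3.Theorems.Transplant.SkelFrmFromBParamsKitS
import Summits.CriticalPhenomena.PercolationContinuityZ3.Theorems.Transplant.SkelFrmBParamsKitS
import HarnessLib
import Summits.CriticalPhenomena.PercolationContinuityZ3.Theorems.Transplant.SkelFrmBChoiceResidF2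
/-!
# U-WAVE PORT (RULING D-U, lead g21 2026-08-26; WAVE-U-MANIFEST v3.0 row «SkelFrmBChoiceResidF2» ↦ «SkelFrmFromBChoiceResidF2») of the tree module
# `Transplant/SkelFrmBChoiceResidF2` onto the carrier `PlanarSkeletonFrmFrom` (frames only, cylinders connected from width `ℓ₀` on)

ORIGINAL TITLE: N2 (frames-only node `SamePDropOfSkeletonFrm₁`, OPEN) — (ζ″) ledger: THE (F)-COLUMN EXCESS RESIDUAL OF THE WRAPPER `NegB.exF2` AND ITS FLOOR LEMMAS

builds on p205010 (kernel theorem, internal audit signed; external expert review pending) — nothing in this file uses p205010; NOTHING is claimed about the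
OPEN node U `SamePDropOfSkeletonFrmFrom₁` (nor U_s / the end state).  Lane `prim-bschramm`, seat `prim-hp-8 gen 53 (U-wave port pen, family P-hp8; tool of record = p3-g26 port_u.py)`; helper file
(`--supports stmt-CriticalPhenomena-4575 --as helper`).  PORT RULES r1–r4 of RULING D-U: declaration order and proof texts are those of the original,
byte-identical except (i) the carrier token `PlanarSkeletonFrm ↦ PlanarSkeletonFrmFrom` (binders, `namespace`/`end` lines, qualified names of twinned
declarations), (ii) carrier-FREE declarations of the original (φ-level `Skelφ…` blocks and namespace-only arithmetic residents) are NOT re-declared —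
this file imports the original and `export`s the twin-free residents (POLICY T / treatment (m1)); residents whose statement mentions a twinned
constant are copied, (iii) every carrier-binding declaration keeps its explicit binder `(Φ : PlanarSkeletonFrmFrom G)` in its own signature (r2).  Docstrings and citations are the original's.  Manifest row idx 215 (level 22; flags verbatim|DEF-ROW); filed by the hp-8 lineage under RULING M-11 (family P-hp8).
-/

noncomputable section

open scoped Classical

namespace Summit.CriticalPhenomena.PercolationContinuityZ3.Theorems.Transplant

open Literature.Probability.Percolation Literature.Probability.LatticeModels SimpleGraph
open SkelConc (Consts)
open Skelφ.StepI (DataNS OutNS)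
open Neg

namespace PlanarSkeletonFrmFrom

namespace NegB

/-! ## §1 The wrapper's (F)-column excess residual -/

/-- **The (F) wrapper's EXCESS residual** `exF2 mk c := max (exFc mk c) (max (Rs mk) (max (r₀0 mk R_b) (max (r₀0 mk R_L) (YbF c mk))))`
(see the module docstring). [this work] -/
def exF2 (mk c : ℕ) : GSlot := fun κ _ _ _ _ _ Φ t p D g f =>
  max (exFc mk c κ Φ t p D g f) (max (KS.Rs t D mk) (max (KS0.r₀0 t D mk (D.R (D.toDataN.scale t (KS.MBF κ Φ t p D c mk) (KS.nBF κ Φ t p D c mk)))) (max (KS0.r₀0 t D mk (RLD κ Φ t p D g f)) (KS.YbF κ Φ t p D c mk g f))))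

section Floors

variable (κ : Consts) {V : Type} [DecidableEq V] [Countable V] {G : SimpleGraph V} [G.LocallyFinite] (Φ : PlanarSkeletonFrmFrom G) (t : V) (p : unitInterval)
  (D : DataNS V) (g f mk c : ℕ)

/-- `exF2` by name. [folklore] -/
theorem exF2_at (κ : Consts) {V : Type} [DecidableEq V] [Countable V] {G : SimpleGraph V} [G.LocallyFinite] (Φ : PlanarSkeletonFrmFrom G) (t : V) (p : unitInterval) (D : DataNS V) (g : ℕ) (f : ℕ) (mk : ℕ) (c : ℕ) : exF2 mk c κ Φ t p D g f =
    max (exFc mk c κ Φ t p D g f) (max (KS.Rs t D mk) (max (KS0.r₀0 t D mk (D.R (D.toDataN.scale t (KS.MBF κ Φ t p D c mk) (KS.nBF κ Φ t p D c mk)))) (max (KS0.r₀0 t D mk (RLD κ Φ t p D g f)) (KS.YbF κ Φ t p D c mk g f)))) := rfl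

/-- **The five floors inside `exF2`**: `exFc ≤ exF2`, `Rs ≤ exF2`, `r₀0 R_b ≤ exF2`, `r₀0 R_L ≤ exF2`, `YbF ≤ exF2`. [folklore] -/
theorem exF2_floors (κ : Consts) {V : Type} [DecidableEq V] [Countable V] {G : SimpleGraph V} [G.LocallyFinite] (Φ : PlanarSkeletonFrmFrom G) (t : V) (p : unitInterval) (D : DataNS V) (g : ℕ) (f : ℕ) (mk : ℕ) (c : ℕ) : exFc mk c κ Φ t p D g f ≤ exF2 mk c κ Φ t p D g f ∧ KS.Rs t D mk ≤ exF2 mk c κ Φ t p D g f ∧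
    KS0.r₀0 t D mk (D.R (D.toDataN.scale t (KS.MBF κ Φ t p D c mk) (KS.nBF κ Φ t p D c mk))) ≤ exF2 mk c κ Φ t p D g f ∧
      KS0.r₀0 t D mk (RLD κ Φ t p D g f) ≤ exF2 mk c κ Φ t p D g f ∧ KS.YbF κ Φ t p D c mk g f ≤ exF2 mk c κ Φ t p D g f := by
  refine ⟨?_, ?_, ?_, ?_, ?_⟩ <;> rw [exF2_at] <;> omega

/-- **The derived floors**: `base0 ≤ exF2`, `reach0 ≤ exF2`, `R_b + reach0 ≤ exF2`, `R_L + reach0 ≤ exF2`, `πBudX ≤ exF2`, `πBudY ≤ exF2`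
(`r₀0 X = max base0 (X + reach0)`, `exFc = max πBudX πBudY`). [folklore] -/
theorem exF2_floors' (κ : Consts) {V : Type} [DecidableEq V] [Countable V] {G : SimpleGraph V} [G.LocallyFinite] (Φ : PlanarSkeletonFrmFrom G) (t : V) (p : unitInterval) (D : DataNS V) (g : ℕ) (f : ℕ) (mk : ℕ) (c : ℕ) : KS0.base0 t D mk ≤ exF2 mk c κ Φ t p D g f ∧ KS0.reach0 t D mk ≤ exF2 mk c κ Φ t p D g f ∧
    (D.R (D.toDataN.scale t (KS.MBF κ Φ t p D c mk) (KS.nBF κ Φ t p D c mk))) + KS0.reach0 t D mk ≤ exF2 mk c κ Φ t p D g f ∧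
      (RLD κ Φ t p D g f) + KS0.reach0 t D mk ≤ exF2 mk c κ Φ t p D g f ∧
        KS.πBudX κ Φ t p D c mk g f ≤ exF2 mk c κ Φ t p D g f ∧ KS.πBudY κ Φ t p D c mk g f ≤ exF2 mk c κ Φ t p D g f := by
  obtain ⟨h1, -, h3, h4, -⟩ := exF2_floors κ Φ t p D g f mk c
  have hb := KS0.r₀0_ge t D mk (D.R (D.toDataN.scale t (KS.MBF κ Φ t p D c mk) (KS.nBF κ Φ t p D c mk)))
  have hl := KS0.r₀0_ge t D mk (RLD κ Φ t p D g f)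
  have hc := exFc_floors κ Φ t p D g f mk c
  omega

end Floors

/-! ## §2 Transfer to a dominating slot value -/

section Transfer

variable {κ : Consts} {V : Type} [DecidableEq V] [Countable V] {G : SimpleGraph V} [G.LocallyFinite] {Φ : PlanarSkeletonFrmFrom G} {t : V} {p : unitInterval}
  {mk c : ℕ}

/-- **`exFc ≤ ex`** from any excess residual dominating `exF2` (so ResidF's `hπX_of_ge/hπY_of_ge` apply). [folklore] -/
theorem exFc_le_of_ge2 {κ : Consts} {V : Type} [DecidableEq V] [Countable V] {G : SimpleGraph V} [G.LocallyFinite] {Φ : PlanarSkeletonFrmFrom G} {t : V} {p : unitInterval} {mk : ℕ} {c : ℕ} {ex : GSlot} (h : ∀ (D : DataNS V) (g f : ℕ), exF2 mk c κ Φ t p D g f ≤ ex κ Φ t p D g f) (D : DataNS V) (g f : ℕ) :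
    exFc mk c κ Φ t p D g f ≤ ex κ Φ t p D g f :=
  (exF2_floors κ Φ t p D g f mk c).1.trans (h D g f)

/-- **The slot rows' floors at `(D, g, f)`** from any excess residual dominating `exF2`: `Rs ≤ ex`, `r₀0 R_b ≤ ex`, `r₀0 R_L ≤ ex`, `YbF ≤ ex`,
`base0 ≤ ex`, `reach0 ≤ ex`, `πBudX ≤ ex`, `πBudY ≤ ex`. [folklore] -/
theorem floors_of_ge2 {κ : Consts} {V : Type} [DecidableEq V] [Countable V] {G : SimpleGraph V} [G.LocallyFinite] {Φ : PlanarSkeletonFrmFrom G} {t : V} {p : unitInterval} {mk : ℕ} {c : ℕ} {ex : GSlot} (h : ∀ (D : DataNS V) (g f : ℕ), exF2 mk c κ Φ t p D g f ≤ ex κ Φ t p D g f) (D : DataNS V) (g f : ℕ) :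
    KS.Rs t D mk ≤ ex κ Φ t p D g f ∧ KS0.r₀0 t D mk (D.R (D.toDataN.scale t (KS.MBF κ Φ t p D c mk) (KS.nBF κ Φ t p D c mk))) ≤ ex κ Φ t p D g f ∧
      KS0.r₀0 t D mk (RLD κ Φ t p D g f) ≤ ex κ Φ t p D g f ∧ KS.YbF κ Φ t p D c mk g f ≤ ex κ Φ t p D g f ∧
        KS0.base0 t D mk ≤ ex κ Φ t p D g f ∧ KS0.reach0 t D mk ≤ ex κ Φ t p D g f ∧
          KS.πBudX κ Φ t p D c mk g f ≤ ex κ Φ t p D g f ∧ KS.πBudY κ Φ t p D c mk g f ≤ ex κ Φ t p D g f := by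
  have hx := h D g f
  obtain ⟨-, h2, h3, h4, h5⟩ := exF2_floors κ Φ t p D g f mk c
  obtain ⟨h6, h7, -, -, h8, h9⟩ := exF2_floors' κ Φ t p D g f mk c
  exact ⟨h2.trans hx, h3.trans hx, h4.trans hx, h5.trans hx, h6.trans hx, h7.trans hx, h8.trans hx, h9.trans hx⟩

end Transfer

/-! ## §3 The (F) demand on the rim-diameter slot: `mxF` (hp-8 g44; the node tuple's `mxR := NegB.mxF 0`, lead g14 J27 / coherence rule) -/

/-- **The (F) column's RIM-DIAMETER demand** `mxF mk : GSlot := ⌈m_F⌉₊` — the face block ceiling `(prFA D g f).mF (fcellsA D g f)` as a natural number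
(`Int.toNat`; the wrapper's `hmx : m_F ≤ mx` holds at any `mx ⊒ mxF mk`; the index `mk` is carried for the tuple's uniform shape only). [this work] -/
def mxF (_mk : ℕ) : GSlot := fun κ _ _ _ _ _ Φ t p D g f => ((prFA κ Φ t p D g f).mF (fcellsA κ Φ t p D g f)).toNat

section MxF

variable (κ : Consts) {V : Type} [DecidableEq V] [Countable V] {G : SimpleGraph V} [G.LocallyFinite] (Φ : PlanarSkeletonFrmFrom G) (t : V) (p : unitInterval)
  (D : DataNS V) (g f mk : ℕ)

/-- `mxF` by name. [folklore] -/
theorem mxF_at (κ : Consts) {V : Type} [DecidableEq V] [Countable V] {G : SimpleGraph V} [G.LocallyFinite] (Φ : PlanarSkeletonFrmFrom G) (t : V) (p : unitInterval) (D : DataNS V) (g : ℕ) (f : ℕ) (mk : ℕ) : mxF mk κ Φ t p D g f = ((prFA κ Φ t p D g f).mF (fcellsA κ Φ t p D g f)).toNat := rfl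

/-- **`hmx` at `mx := mxF mk`**: `m_F ≤ mxF mk` (in `ℤ`). [folklore] -/
theorem mF_le_mxF (κ : Consts) {V : Type} [DecidableEq V] [Countable V] {G : SimpleGraph V} [G.LocallyFinite] (Φ : PlanarSkeletonFrmFrom G) (t : V) (p : unitInterval) (D : DataNS V) (g : ℕ) (f : ℕ) (mk : ℕ) : (prFA κ Φ t p D g f).mF (fcellsA κ Φ t p D g f) ≤ (((mxF mk κ Φ t p D g f) : ℕ) : ℤ) := by
  rw [mxF_at]; exact Int.self_le_toNat _

/-- **`hmx` at any `mx ⊒ mxF mk`.** [folklore] -/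
theorem mF_le_of_ge (κ : Consts) {V : Type} [DecidableEq V] [Countable V] {G : SimpleGraph V} [G.LocallyFinite] (Φ : PlanarSkeletonFrmFrom G) (t : V) (p : unitInterval) (D : DataNS V) (g : ℕ) (f : ℕ) (mk : ℕ) {mx : GSlot} (h : ∀ (D : DataNS V) (g f : ℕ), mxF mk κ Φ t p D g f ≤ mx κ Φ t p D g f) :
    (prFA κ Φ t p D g f).mF (fcellsA κ Φ t p D g f) ≤ (((mx κ Φ t p D g f) : ℕ) : ℤ) :=
  (mF_le_mxF κ Φ t p D g f mk).trans (by exact_mod_cast h D g f)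

end MxF

end NegB

end PlanarSkeletonFrmFrom

end Summit.CriticalPhenomena.PercolationContinuityZ3.Theorems.Transplant

end
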